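import Literature.AlgebraicGeometry.Resolution.ResolutionOfComponents
import Literature.AlgebraicGeometry.Resolution.QuasiProjectiveResolution
import Literature.AlgebraicGeometry.Resolution.PrincipalizationToResolution
import Literature.AlgebraicGeometry.Resolution.AlterationsDimension
import Literature.AlgebraicGeometry.Resolution.AlterationsModification
import Literature.AlgebraicGeometry.Resolution.ChowLemmaProofs
import Mathlib.AlgebraicGeometry.Morphisms.Immersion
import HarnessLib

/-!
# Weak resolution up to dimension `d`: reduction to projective integral schemes

Topic: `Literature/AlgebraicGeometry/Resolution`. The first reduction in Zariski's and
Cossart–Piltant's patching arguments (Cossart–Piltant 2019, proof of Prop. 4.6 [arXiv v1: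
Prop. 4.4], Steps 1–2; Zariski–Samuel II, Ch. VI §17: one works with PROJECTIVE models of the
function field): to prove weak resolution (`Scheme.HasResolution`: a proper birational morphism
from a regular scheme) of every reduced separated `k`-scheme of finite type of dimension `≤ d`
(`ResolutionOverUpToDim k d`, `ArithmeticalThreefolds.lean`) it suffices to resolve the INTEGRAL
CLOSED SUBSCHEMES OF THE PROJECTIVE SPACES `ℙⁿ_k` of dimension `≤ d`. PROVED, from results of the
tree:

* the integral case suffices (`resolutionOverUpToDim_iff_integral`, the irreducible components);
* Chow's lemma, integral form (`ChowLemmaIntegral_holds`, Görtz–Wedhorn Thm. 13.100): an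
  integral separated `X` of finite type over `k` receives a proper birational `π : X' → X` from an
  integral `X'` with an immersion `ι : X' ↪ ℙⁿ_k`;
* the scheme-theoretic image `X̄'` of the quasi-compact immersion `ι` is an integral closed
  subscheme of `ℙⁿ_k` containing `X'` as an open subscheme (Mathlib: `ι.toImage` is an open
  immersion, `ι.imageι` a closed immersion; `ChowLemmaProof.isIntegral_image`);
* dimensions: `dim X̄' = dim X'` (a non-empty open of an integral scheme locally of finite type
  over a field, `topologicalKrullDim_eq_of_isOpenImmersion`, GW Thm. 5.22 (3)) and
  `dim X' = dim X` (a modification is an alteration and alterations preserve dimension,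
  `IsBirational.isAlteration`, `IsAlteration.topologicalKrullDim_eq`, de Jong 2.20);
* resolutions restrict to opens and descend along proper birational morphisms
  (`Scheme.HasResolution.of_isOpenImmersion`, `Scheme.HasResolution.of_isBirational`).

## Main result

* `ResolutionOverUpToDim.of_projective` — if every integral `X` with a closed immersion into
  some `ℙⁿ_k` and `dim X ≤ d` has a resolution, then `ResolutionOverUpToDim k d`.
* `resolutionOverUpToDim_iff_projective` — the equivalence.

## References

* V. Cossart, O. Piltant, J. Algebra 529 (2019), proof of Prop. 4.6 (arXiv:1412.0868v1:
  Prop. 4.4), Steps 1–3. [CossartPiltant2019]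
* U. Görtz, T. Wedhorn, *Algebraic Geometry I*, 2nd ed. (2020), Thm. 13.100, Thm. 5.22.
  [GortzWedhorn2020]
* O. Zariski, P. Samuel, *Commutative Algebra* II, Ch. VI §17. [ZariskiSamuel1960]
-/

noncomputable section

open CategoryTheory AlgebraicGeometry TopologicalSpace

namespace Literature.AlgebraicGeometry.Resolution

universe u

variable {k : Type u} [Field k]

/-- An integral scheme with an immersion into `ℙⁿ_k` is a Noetherian topological space (a
subspace of the Noetherian `ℙⁿ_k`), so every morphism out of it is quasi-compact. [folklore] -/
theorem noetherianSpace_of_isImmersion_projectiveSpace {n : ℕ} {X : Scheme.{u}}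
    (ι : X ⟶ (Motives.projectiveSpace n k).left) [IsImmersion ι] : NoetherianSpace X := by
  haveI : IsProper (Motives.projectiveSpace n k).hom := Motives.isProper_projectiveSpace n k
  haveI : IsLocallyNoetherian (Motives.projectiveSpace n k).left :=
    LocallyOfFiniteType.isLocallyNoetherian (Motives.projectiveSpace n k).hom
  haveI : CompactSpace (Motives.projectiveSpace n k).left :=
    QuasiCompact.compactSpace_of_compactSpace (Motives.projectiveSpace n k).hom
  haveI : IsNoetherian (Motives.projectiveSpace n k).left := {}
  exact ι.isEmbedding.isInducing.noetherianSpace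

/-- **Projective closure.** An integral scheme `X` with an immersion `ι : X ↪ ℙⁿ_k` is an open
subscheme of an integral closed subscheme `X̄` of `ℙⁿ_k` of the same dimension: `X̄` is the
scheme-theoretic image of `ι` (Görtz–Wedhorn, Rem. 10.32 / proof of Thm. 13.100, Step 2: a
quasi-compact immersion factors as an open immersion into its schematic closure followed by a
closed immersion). [cite: GortzWedhorn2020, Thm 13.100 (proof, Step 2)] -/
theorem exists_projectiveClosure {n : ℕ} {X : Scheme.{u}} [IsIntegral X]
    (ι : X ⟶ (Motives.projectiveSpace n k).left) [IsImmersion ι] :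
    ∃ (Xbar : Scheme.{u}) (j : X ⟶ Xbar) (c : Xbar ⟶ (Motives.projectiveSpace n k).left),
      IsIntegral Xbar ∧ IsOpenImmersion j ∧ IsClosedImmersion c ∧ j ≫ c = ι ∧
        topologicalKrullDim Xbar = topologicalKrullDim X := by
  haveI : NoetherianSpace X := noetherianSpace_of_isImmersion_projectiveSpace ι
  haveI : QuasiCompact ι := inferInstance
  haveI : IsIntegral ι.image := ChowLemmaProof.isIntegral_image ι
  haveI : IsProper (Motives.projectiveSpace n k).hom := Motives.isProper_projectiveSpace n k
  refine ⟨ι.image, ι.toImage, ι.imageι, inferInstance, inferInstance, inferInstance,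
    Scheme.Hom.toImage_imageι ι, ?_⟩
  haveI : Nonempty X := ⟨genericPoint X⟩
  exact (topologicalKrullDim_eq_of_isOpenImmersion
    (ι.imageι ≫ (Motives.projectiveSpace n k).hom) ι.toImage).symm

/-- **Weak resolution up to dimension `d` reduces to integral closed subschemes of projective
spaces.** If every integral scheme `X` admitting a closed immersion into some `ℙⁿ_k`, with
`dim X ≤ d`, has a resolution of singularities, then so does every reduced separated `k`-scheme
of finite type of dimension `≤ d`: pass to an irreducible component
(`resolutionOverUpToDim_iff_integral`), then by Chow's lemma (`ChowLemmaIntegral_holds`) to a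
proper birational integral `X' → X` immersed in `ℙⁿ_k` (`Scheme.HasResolution.of_isBirational`;
`dim X' = dim X`, `IsAlteration.topologicalKrullDim_eq`), then to its projective closure
(`exists_projectiveClosure`, `Scheme.HasResolution.of_isOpenImmersion`). This is the reduction
"it can be assumed that `𝒳` is irreducible … projective" of the patching arguments
(Cossart–Piltant 2019, proof of Prop. 4.6, Steps 1–3; Zariski–Samuel II, Ch. VI §17).
[cite: CossartPiltant2019, Prop. 4.6 (arXiv v1: Prop. 4.4), proof, Steps 1–3] -/
theorem ResolutionOverUpToDim.of_projective {d : ℕ}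
    (h : ∀ (n : ℕ) (X : Scheme.{u}) (ι : X ⟶ (Motives.projectiveSpace n k).left),
      IsClosedImmersion ι → IsIntegral X → topologicalKrullDim X ≤ d → Scheme.HasResolution X) :
    ResolutionOverUpToDim k d := by
  refine resolutionOverUpToDim_iff_integral.mpr fun X f hsep hft hqc hint hdim => ?_
  obtain ⟨n, X', π, ι, hint', hι, hπ, -, -, U, hU, hU', hiso⟩ :=
    ChowLemmaIntegral_holds k X f hsep hft hqc hint
  haveI := hπ
  haveI := hι
  haveI := hint'
  have hbir : IsBirational π := ⟨U, hU, hU', hiso⟩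
  -- `dim X' = dim X`
  have hdim' : topologicalKrullDim X' ≤ d := by
    rw [(hbir.isAlteration).topologicalKrullDim_eq f]
    exact hdim
  -- the projective closure of `X'`
  obtain ⟨Xbar, j, c, hXbar, hj, hc, -, hdimbar⟩ := exists_projectiveClosure ι
  haveI := hj
  have hres : Scheme.HasResolution Xbar := h n Xbar c hc hXbar (hdimbar ▸ hdim')
  exact Scheme.HasResolution.of_isBirational π hbir (hres.of_isOpenImmersion j)

/-- Conversely `ResolutionOverUpToDim k d` contains the projective integral case: a closed
subscheme of `ℙⁿ_k` is a reduced separated `k`-scheme of finite type (`ℙⁿ_k → Spec k` is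
proper, `Literature.AlgebraicGeometry.Motives.isProper_projectiveSpace`). [folklore] -/
theorem ResolutionOverUpToDim.projective {d : ℕ} (h : ResolutionOverUpToDim k d) (n : ℕ)
    (X : Scheme.{u}) (ι : X ⟶ (Motives.projectiveSpace n k).left) [IsClosedImmersion ι]
    [IsIntegral X] (hdim : topologicalKrullDim X ≤ d) : Scheme.HasResolution X := by
  haveI : IsProper (Motives.projectiveSpace n k).hom := Motives.isProper_projectiveSpace n k
  exact h X (ι ≫ (Motives.projectiveSpace n k).hom) inferInstance inferInstance inferInstance
    inferInstance hdim

/-- **`ResolutionOverUpToDim k d` is equivalent to its projective integral case.**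
[cite: CossartPiltant2019, Prop. 4.6 (arXiv v1: Prop. 4.4), proof, Steps 1–3] -/
theorem resolutionOverUpToDim_iff_projective {d : ℕ} :
    ResolutionOverUpToDim k d ↔
      ∀ (n : ℕ) (X : Scheme.{u}) (ι : X ⟶ (Motives.projectiveSpace n k).left),
        IsClosedImmersion ι → IsIntegral X → topologicalKrullDim X ≤ d →
          Scheme.HasResolution X :=
  ⟨fun h n X ι hι hint hdim => by
    haveI := hι; haveI := hint; exact h.projective n X ι hdim,
    ResolutionOverUpToDim.of_projective⟩

end Literature.AlgebraicGeometry.Resolution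

end
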